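import Summits.Langlands.Langlands.Theorems.HalfIntegralTwistCM.Negative.ModulusParallel
import HarnessLib

/-!
# `HalfIntegralTwistCM` (stmt-Langlands-14036) — negative knowledge IV: `IsCMField` is load-bearing

Sorry-free and UNCONDITIONAL (cdisprove cycle 1). The crux with `NumberField.IsCMField K →` removed is
FALSE over every number field with two real places `w₁ ≠ w₂`
(`halfIntegralTwistCM_false_without_isCMField_of_two_real_places`), concretely over
`K = ℚ(ζ₅)⁺ = ℚ(√5)` (`halfIntegralTwistCM_false_without_isCMField`): with `s₁ = (0 at σ_{w₁}, 1/2 at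
σ_{w₂})`, `s₂ = -s₁`, `ω = π_𝟙`, hypotheses (i)–(iv) hold and a re-twist would need `Re c_{w₁} ∈ 1/2 + ℤ`,
`Re c_{w₂} ∈ ℤ`, contradicting the parallelism of real parts (`exists_re_archParam_parallel_glOne`).
Patrikis 2019, Prop. 1.3.3 / Lemma 2.1.5 in its crudest form; no unit of infinite order is needed.
[folklore]
-/

noncomputable section

open scoped MatrixGroups Matrix Classical NumberField ComplexConjugate
open NumberField NumberField.InfinitePlace NumberField.mixedEmbedding IsDedekindDomain

namespace Summit.Langlands.Langlands.Theorems.HalfIntegralTwistCM.Negative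

open Literature.NumberTheory.Automorphic
open Literature.NumberTheory.GaloisRepresentations

variable {K : Type} [Field K] [NumberField K] {hcpt : isCompact_glFiniteIntegralLevel 1 K}

/-- **`IsCMField` is load-bearing: the crux without it FAILS over every number field with two real
places** (unconditional). Witness `s₁ = (1/2)·𝟙_{σ_{w₂}}`, `s₂ = -s₁`, `ω = π_𝟙`; obstruction
`exists_re_archParam_parallel_glOne`. Patrikis 2019, Prop. 1.3.3 / Lemma 2.1.5 (the real-place
obstruction `X*(Z)[2] = ℤ/2` per real place), here in its crudest form. [cite: Patrikis2019, Lemma 2.1.5] -/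
theorem halfIntegralTwistCM_false_without_isCMField_of_two_real_places {K : Type} [Field K] [NumberField K]
    (w₁ w₂ : {w : InfinitePlace K // w.IsReal}) (hne : w₁ ≠ w₂) :
    ¬ (∀ (K : Type) [Field K] [NumberField K],
        ∀ (h1 : Literature.NumberTheory.Automorphic.isCompact_glFiniteIntegralLevel 1 K)
          (s₁ s₂ : (K →+* ℂ) → ℂ), (∀ ι, ∃ k : ℤ, s₁ ι - s₂ ι = k) →
          (∀ ι, ∃ m : ℤ, s₁ ι - s₁ (NumberField.ComplexEmbedding.conjugate ι) = m) →
          (∀ ι, ∃ m : ℤ, (s₁ ι - s₂ ι) + (s₁ (NumberField.ComplexEmbedding.conjugate ι) -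
            s₂ (NumberField.ComplexEmbedding.conjugate ι)) = 2 * m) →
          (∃ ω : Literature.NumberTheory.Automorphic.CuspidalAutomorphicRepData 1 K h1,
            ω.1.HasArchParameter (fun ι => {s₁ ι + s₂ ι})) →
          ∃ (χ : Literature.NumberTheory.Automorphic.CuspidalAutomorphicRepData 1 K h1)
            (p : (K →+* ℂ) → ℂ), χ.1.HasArchParameter (fun ι => {p ι}) ∧
              ∀ ι, ∃ m : ℤ, p ι + s₁ ι - 1 / 2 = m) := by
  intro hC
  classical
  set σ₂ : K →+* ℂ := w₂.1.embedding with hσ₂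
  have hσ₂real : ComplexEmbedding.IsReal σ₂ := isReal_iff.mp w₂.2
  have hσ₂conj : ComplexEmbedding.conjugate σ₂ = σ₂ := ComplexEmbedding.isReal_iff.mp hσ₂real
  -- `conjugate ι = σ₂ ↔ ι = σ₂`
  have hconj : ∀ ι : K →+* ℂ, ComplexEmbedding.conjugate ι = σ₂ ↔ ι = σ₂ := by
    intro ι
    constructor
    · intro h
      have hcc : ComplexEmbedding.conjugate (ComplexEmbedding.conjugate ι) = ι :=
        RingHom.ext fun x => by simp
      have := congrArg ComplexEmbedding.conjugate h
      rwa [hσ₂conj, hcc] at this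
    · rintro rfl
      exact hσ₂conj
  set h1 : isCompact_glFiniteIntegralLevel 1 K := isCompact_glFiniteIntegralLevel_holds 1 K with hh1
  -- the exponents
  set s₁ : (K →+* ℂ) → ℂ := fun ι => if ι = σ₂ then 1 / 2 else 0 with hs₁
  -- the trivial datum
  obtain ⟨τ, hτW, hτW'⟩ := exists_automorphicRepData_detTwist_glOne h1 (1 : HeckeCharacter K)
  have hcusp : τ.W ≤ cuspFormsGL 1 K h1 := by
    rw [hτW, Submodule.span_le]
    rintro _ rfl
    exact IsCuspFormGL.mem_cuspFormsGL
      ⟨isAutomorphicForm_detTwist_glOne h1 (1 : HeckeCharacter K), fun k hk hk1 => absurd hk1 (by omega)⟩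
  have hχτ := detTwist_datum_heckeCharacter (hcpt := h1) (θ := (1 : HeckeCharacter K)) hτW
  obtain ⟨E, hE⟩ := τ.exists_hasArchParameter_glOne
  have hE0 : E = fun ι => ({s₁ ι + -s₁ ι} : Multiset ℂ) := by
    funext ι
    rw [add_neg_cancel]
    exact archParam_trivial_glOne τ hχτ hE ι
  -- apply the CM-free crux
  obtain ⟨χ, P, hP, hint⟩ := hC K h1 s₁ (fun ι => -s₁ ι)
    (fun ι => by
      by_cases h : ι = σ₂
      · exact ⟨1, by simp [hs₁, h]; norm_num⟩
      · exact ⟨0, by simp [hs₁, h]⟩)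
    (fun ι => ⟨0, by
      by_cases h : ι = σ₂
      · simp [hs₁, h, hσ₂conj]
      · have h' : ¬ ComplexEmbedding.conjugate ι = σ₂ := fun h'' => h ((hconj ι).1 h'')
        simp [hs₁, h, h']⟩)
    (fun ι => by
      by_cases h : ι = σ₂
      · exact ⟨1, by simp [hs₁, h, hσ₂conj]; norm_num⟩
      · have h' : ¬ ComplexEmbedding.conjugate ι = σ₂ := fun h'' => h ((hconj ι).1 h'')
        exact ⟨0, by simp [hs₁, h, h']⟩)
    ⟨⟨τ, hcusp⟩, by rw [← hE0]; exact hE⟩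
  -- the parallel real parts
  obtain ⟨σ, hreal, -⟩ := exists_re_archParam_parallel_glOne χ.1 hP
  have h₁ := hreal w₁ (P w₁.1.embedding) rfl
  have h₂ := hreal w₂ (P w₂.1.embedding) rfl
  have hne' : w₁.1.embedding ≠ σ₂ := fun h => hne (Subtype.ext (by
    have := congrArg InfinitePlace.mk h
    rwa [mk_embedding, hσ₂, mk_embedding] at this))
  obtain ⟨m₁, hm₁⟩ := hint w₁.1.embedding
  obtain ⟨m₂, hm₂⟩ := hint σ₂
  have e₁ : s₁ w₁.1.embedding = 0 := by simp [hs₁, hne']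
  have e₂ : s₁ σ₂ = 1 / 2 := by simp [hs₁]
  rw [e₁] at hm₁
  rw [e₂] at hm₂
  have r₁ := congrArg Complex.re hm₁
  have r₂ := congrArg Complex.re hm₂
  simp only [Complex.sub_re, Complex.add_re, Complex.zero_re, Complex.intCast_re] at r₁ r₂
  rw [h₁] at r₁
  rw [← hσ₂] at h₂
  rw [h₂] at r₂
  have half : ((1 : ℂ) / 2).re = 1 / 2 := by norm_num
  rw [half] at r₁ r₂
  have key : (2 * (m₂ - m₁) : ℝ) = 1 := by linarith
  have key' : (2 * (m₂ - m₁) : ℤ) = 1 := by exact_mod_cast key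
  omega

/-! ### The witness field `ℚ(ζ₅)⁺ = ℚ(√5)` -/

/-- The fifth cyclotomic field `ℚ(ζ₅)`. [folklore] -/
abbrev K₅ : Type := CyclotomicField 5 ℚ

/-- `ℚ(ζ₅)/ℚ` is the cyclotomic extension of level `5` (Mathlib's instance, named). [folklore] -/
theorem isCyclotomicExtension_K₅ : IsCyclotomicExtension {5} ℚ K₅ :=
  CyclotomicField.isCyclotomicExtension 5 ℚ


/-- `ℚ(ζ₅)` is CM. [folklore] -/
theorem isCMField_K₅ : NumberField.IsCMField K₅ :=
  haveI := isCyclotomicExtension_K₅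
  IsCyclotomicExtension.Rat.isCMField K₅ (S := {5}) ⟨5, Set.mem_singleton 5, by norm_num⟩


/-- The maximal real subfield `ℚ(ζ₅)⁺ = ℚ(√5)`, a totally real number field. [folklore] -/
abbrev K₅plus : Type := NumberField.maximalRealSubfield K₅

/-- `ℚ(ζ₅)⁺` has two (real) infinite places (`φ(5)/2 = 2`). [folklore] -/
theorem card_infinitePlace_K₅plus : Fintype.card (InfinitePlace K₅plus) = 2 := by
  haveI := isCyclotomicExtension_K₅
  haveI := isCMField_K₅
  rw [NumberField.IsCMField.card_infinitePlace_eq_card_infinitePlace K₅,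
    card_eq_nrRealPlaces_add_nrComplexPlaces,
    IsCyclotomicExtension.Rat.nrRealPlaces_eq_zero (n := 5) K₅ (by decide), zero_add,
    IsCyclotomicExtension.Rat.nrComplexPlaces_eq_totient_div_two (n := 5)]
  rfl

/-- **`IsCMField` is load-bearing: the crux WITHOUT `IsCMField` is FALSE**, unconditionally (witness `ℚ(√5)`, two
real places). Any proof of the crux must USE the CM hypothesis — precisely, the absence of real places
(the statement also holds for `K = ℚ` and imaginary quadratic `K`, finding F3(d)).
[cite: Patrikis2019, Lemma 2.1.5] -/
theorem halfIntegralTwistCM_false_without_isCMField :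
    ¬ (∀ (K : Type) [Field K] [NumberField K],
        ∀ (h1 : Literature.NumberTheory.Automorphic.isCompact_glFiniteIntegralLevel 1 K)
          (s₁ s₂ : (K →+* ℂ) → ℂ), (∀ ι, ∃ k : ℤ, s₁ ι - s₂ ι = k) →
          (∀ ι, ∃ m : ℤ, s₁ ι - s₁ (NumberField.ComplexEmbedding.conjugate ι) = m) →
          (∀ ι, ∃ m : ℤ, (s₁ ι - s₂ ι) + (s₁ (NumberField.ComplexEmbedding.conjugate ι) -
            s₂ (NumberField.ComplexEmbedding.conjugate ι)) = 2 * m) →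
          (∃ ω : Literature.NumberTheory.Automorphic.CuspidalAutomorphicRepData 1 K h1,
            ω.1.HasArchParameter (fun ι => {s₁ ι + s₂ ι})) →
          ∃ (χ : Literature.NumberTheory.Automorphic.CuspidalAutomorphicRepData 1 K h1)
            (p : (K →+* ℂ) → ℂ), χ.1.HasArchParameter (fun ι => {p ι}) ∧
              ∀ ι, ∃ m : ℤ, p ι + s₁ ι - 1 / 2 = m) := by
  have h : 1 < Fintype.card (InfinitePlace K₅plus) := by
    rw [card_infinitePlace_K₅plus]; decide
  obtain ⟨w₁, w₂, hne⟩ := Fintype.exists_pair_of_one_lt_card h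
  exact halfIntegralTwistCM_false_without_isCMField_of_two_real_places (K := K₅plus)
    ⟨w₁, NumberField.IsTotallyReal.isReal w₁⟩ ⟨w₂, NumberField.IsTotallyReal.isReal w₂⟩
    (fun e => hne (congrArg Subtype.val e))

end Summit.Langlands.Langlands.Theorems.HalfIntegralTwistCM.Negative
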